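import Mathlib
import Summits.ValiantsHypothesis.ValiantsHypothesis.Theorems.KPlusLogSqLawLiftingThinStrip

/-!
# Route «KPlusLogSqLaw», crux `Lifting` / `WeakLifting` — the registered stub `stub_liftThin` VERBATIM on all sizes `m ≤ 124`
(constant `C = 5`), and the LIFT shape `TropRow m K n → RealRootLawAt m K (2^(5K)(n+1))` for ALL `K` when `m ≤ 124`

HONEST FRAMING.  Partial-range (Descartes-zone) form of the registered stub
`stub_liftThin : ∃ C, ∀ m K n, K ≤ Nat.log 2 m ^ 2 → TropRow m K n → RealRootLawAt m K (2 ^ (C * K) * (n + 1))`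
of the aside crux `Summit.ValiantsHypothesis.ValiantsHypothesis.Theses.KPlusLogSqLaw.Lifting` (item `stmt-ValiantsHypothesis-19772`;
every proof of a strong stub proves the weak stub of the live crux `WeakLifting`, `stmt-ValiantsHypothesis-19561`, a fortiori);
cell `pub-symmetroid`, seat val-sym-lift-p1 g6, 2026-08-27.  The stub itself is OPEN; its `K = 4` rung for all `m` is the cell's
D2 fork (quadratic vs cubic tropical row `(m,4)`; this seat's memo HOME/val-sym-lift-p1/g6/K4-DESIGN-OBSTRUCTIONS.md records why
eleven natural cubic architectures fail).  What IS proved here is elementary and says nothing about the fork: for sizes `m ≤ 124`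
the real Descartes ceiling `ζ(m,K) ≤ 2·C(m+K−1,m) − 1` (`Census.realRootLawAt_descartes`) already fits under
`2^(5K)·(T(m,K)+1)` for EVERY `K ≥ 5`, using only the quadratic tropical floor `C(m+2,2) − 2 ≤ T(m,3) ≤ T(m,K)`
(SHIFT-THREE, `choose_sub_two_le_of_tropRootLawAt_three`, padded by `tropRootLawAt_of_le_classes`): the binomial grows by the
factor `(m+K)/K ≤ 32` per unit of `K` once `m ≤ 31·K`, and `2·C(m+4,4) ≤ 2^25` for `m ≤ 124` starts the induction; `K ≤ 3` and
`K = 4` are the landed strips (`lift_strip_le_three`, `lift_rung_four_of_le`).  So the range `m ≤ 7` of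
`stub_liftThin_of_le_seven` (val-sym-lift-p1 g2) becomes `m ≤ 124`, at the price `C = 5` instead of `3` — a bounded-size
statement of the same Descartes-trivial kind as `weakLifting_boundedK`, NOT evidence about the window.  Nothing here bears on
`Lifting` / `TropicalB` / `WeakLifting` in the window, on the cell's real census or registers, on `MatrixDescartes`
(`stmt-ValiantsHypothesis-18050`) or on `VP ≠ VNP`.

WHAT IS PROVED.
* `two_mul_choose_le_of_le` — `1 ≤ m ≤ 124 → 4 ≤ j → 2·C(m+j, j) ≤ 2^(5(j+1))·(C(m+2,2) − 1)` [elementary];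
* `lift_of_le_124` — `m ≤ 124 → TropRootLawAt m K n → RealRootLawAt m K (2^(5K)·(n+1))` for every `K`;
* `stub_liftThin_of_le_124` — the registered stub's statement VERBATIM restricted to `m ≤ 124`, with `C = 5`.
-/

set_option linter.dupNamespace false
set_option autoImplicit false

namespace Summit.ValiantsHypothesis.ValiantsHypothesis.Theorems.KPlusLogSqLaw

open Summit.ValiantsHypothesis.ValiantsHypothesis.Theorems.LacunarySymmetroidMatrixDescartes (RealRootLawAt)
open Summit.ValiantsHypothesis.ValiantsHypothesis.Theorems.LacunarySymmetroidMatrixDescartes.TropicalCensus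

/-- `2 ≤ C(m+2,2) − 1` for `m ≥ 1`. [elementary] -/
theorem two_le_choose_two_sub_one {m : ℕ} (hm : 1 ≤ m) : 2 ≤ (m + 2).choose 2 - 1 := by
  have h3 : Nat.choose 3 2 ≤ (m + 2).choose 2 := Nat.choose_le_choose 2 (by omega)
  have : Nat.choose 3 2 = 3 := by decide
  omega

/-- **Arithmetic core**: for `1 ≤ m ≤ 124` and `j ≥ 4`, `2·C(m+j, j) ≤ 2^(5(j+1))·(C(m+2,2) − 1)`.
Induction on `j`: the base `2·C(m+4,4) ≤ 2·C(128,4) < 2^26`, and the step `C(m+j+1, j+1)·(j+1) = (m+j+1)·C(m+j,j)`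
with `m+j+1 ≤ 32·(j+1)`. [elementary] -/
theorem two_mul_choose_le_of_le (m j : ℕ) (hm1 : 1 ≤ m) (hm : m ≤ 124) (hj : 4 ≤ j) :
    2 * Nat.choose (m + j) j ≤ 2 ^ (5 * (j + 1)) * ((m + 2).choose 2 - 1) := by
  have hF := two_le_choose_two_sub_one hm1
  induction j, hj using Nat.le_induction with
  | base =>
    have h1 : Nat.choose (m + 4) 4 ≤ Nat.choose 128 4 := Nat.choose_le_choose 4 (by omega)
    have h2 : Nat.choose 128 4 = 10668000 := by
      rw [Nat.choose_eq_descFactorial_div_factorial]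
      simp [Nat.descFactorial_succ, Nat.factorial]
    have h3 : (2 : ℕ) ^ (5 * (4 + 1)) = 33554432 := by norm_num
    rw [h3]
    calc 2 * Nat.choose (m + 4) 4 ≤ 2 * 10668000 := by omega
      _ ≤ 33554432 * 2 := by norm_num
      _ ≤ 33554432 * ((m + 2).choose 2 - 1) := Nat.mul_le_mul_left _ hF
  | succ j hj ih =>
    have key : (m + j + 1) * Nat.choose (m + j) j = Nat.choose (m + j + 1) (j + 1) * (j + 1) :=
      Nat.add_one_mul_choose_eq (m + j) j
    have hb : (m + j + 1) * Nat.choose (m + j) j ≤ (32 * (j + 1)) * Nat.choose (m + j) j :=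
      Nat.mul_le_mul_right _ (by omega)
    have hc : Nat.choose (m + j + 1) (j + 1) * (j + 1) ≤ (32 * Nat.choose (m + j) j) * (j + 1) := by
      calc Nat.choose (m + j + 1) (j + 1) * (j + 1) = (m + j + 1) * Nat.choose (m + j) j := key.symm
        _ ≤ (32 * (j + 1)) * Nat.choose (m + j) j := hb
        _ = (32 * Nat.choose (m + j) j) * (j + 1) := by ring
    have hd : Nat.choose (m + j + 1) (j + 1) ≤ 32 * Nat.choose (m + j) j :=
      Nat.le_of_mul_le_mul_right hc (Nat.succ_pos j)
    have he : (2 : ℕ) ^ (5 * (j + 1 + 1)) = 32 * 2 ^ (5 * (j + 1)) := by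
      rw [show 5 * (j + 1 + 1) = 5 * (j + 1) + 5 by ring, pow_add]; ring
    rw [show m + (j + 1) = m + j + 1 from (Nat.add_assoc m j 1).symm, he]
    calc 2 * Nat.choose (m + j + 1) (j + 1) ≤ 2 * (32 * Nat.choose (m + j) j) := Nat.mul_le_mul_left _ hd
      _ = 32 * (2 * Nat.choose (m + j) j) := by ring
      _ ≤ 32 * (2 ^ (5 * (j + 1)) * ((m + 2).choose 2 - 1)) := Nat.mul_le_mul_left _ ih
      _ = 32 * 2 ^ (5 * (j + 1)) * ((m + 2).choose 2 - 1) := by ring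

/-- empty matrices have no real zeros: `RealRootLawAt 0 K B`. [elementary] -/
theorem realRootLawAt_size_zero (K B : ℕ) : RealRootLawAt 0 K B := by
  intro d S _
  simp [Matrix.det_isEmpty]

/-- **LIFT shape on all sizes `m ≤ 124`, every `K`, constant `2^(5K)`:** `TropRootLawAt m K n → RealRootLawAt m K (2^(5K)·(n+1))`.
(`K ≤ 3`: `lift_strip_le_three`; `K = 4`: `lift_rung_four_of_le`; `K ≥ 5`: Descartes + the quadratic SHIFT-THREE floor +
`two_mul_choose_le_of_le`.)  A bounded-size, Descartes-zone statement; it says nothing about `m → ∞`. -/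
theorem lift_of_le_124 (m K n : ℕ) (hm : m ≤ 124) (h : TropRootLawAt m K n) :
    RealRootLawAt m K (2 ^ (5 * K) * (n + 1)) := by
  rcases Nat.lt_or_ge K 5 with hK5 | hK5
  · -- K ≤ 4: landed strips with constant 2^(3K) ≤ 2^(5K)
    have h4 : RealRootLawAt m K (2 ^ (3 * K) * (n + 1)) := lift_strip_le_four_of_le m K n (by omega) (by omega) h
    exact LacunarySymmetroidMatrixDescartes.Census.realRootLawAt_mono
      (Nat.mul_le_mul_right _ (Nat.pow_le_pow_right (by norm_num) (by omega))) h4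
  · rcases Nat.eq_zero_or_pos m with hm0 | hm1
    · subst hm0; exact realRootLawAt_size_zero K _
    -- K ≥ 5, 1 ≤ m ≤ 124
    have hfloor : (m + 2).choose 2 - 2 ≤ n :=
      LacunarySymmetroidMatrixDescartes.TropicalCensus.choose_sub_two_le_of_tropRootLawAt_three m n
        (tropRootLawAt_of_le_classes (by omega) h)
    have hD := LacunarySymmetroidMatrixDescartes.Census.realRootLawAt_descartes m K (by omega)
    refine LacunarySymmetroidMatrixDescartes.Census.realRootLawAt_mono ?_ hD
    -- 2·C(m+K-1, m) − 1 ≤ 2^(5K)·(n+1)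
    obtain ⟨j, rfl⟩ : ∃ j, K = j + 1 := ⟨K - 1, by omega⟩
    have hj : 4 ≤ j := by omega
    have hsymm : Nat.choose (m + (j + 1) - 1) m = Nat.choose (m + j) j := by
      rw [show m + (j + 1) - 1 = m + j by omega]
      exact Nat.choose_symm_add
    rw [hsymm]
    have hmain := two_mul_choose_le_of_le m j hm1 hm hj
    have hF : (m + 2).choose 2 - 1 ≤ n + 1 := by omega
    calc 2 * Nat.choose (m + j) j - 1 ≤ 2 * Nat.choose (m + j) j := Nat.sub_le _ _
      _ ≤ 2 ^ (5 * (j + 1)) * ((m + 2).choose 2 - 1) := hmain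
      _ ≤ 2 ^ (5 * (j + 1)) * (n + 1) := Nat.mul_le_mul_left _ hF

/-- **The registered stub `stub_liftThin` VERBATIM on all sizes `m ≤ 124`**, with `C = 5` (the regime hypothesis
`K ≤ ⌊log₂ m⌋²` is not even used: for `m ≤ 124` the LIFT inequality holds for every `K`).  Extends `stub_liftThin_of_le_seven`
(`m ≤ 7`, `C = 3`); the stub for all `m` remains OPEN. -/
theorem stub_liftThin_of_le_124 :
    ∃ C : ℕ, ∀ m K n : ℕ, m ≤ 124 → K ≤ Nat.log 2 m ^ 2 → TropRootLawAt m K n →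
      RealRootLawAt m K (2 ^ (C * K) * (n + 1)) :=
  ⟨5, fun m K n hm _ h => lift_of_le_124 m K n hm h⟩

end Summit.ValiantsHypothesis.ValiantsHypothesis.Theorems.KPlusLogSqLaw
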